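import Summits.Ventures.GridStability.Models.StructurePreservingSlabRankOne
import Literature.MathematicalPhysics.PowerSystems.LuriePostnikovSlabPositivity

/-!
# GridStability/Models/StructurePreservingSlabLowerRankOne — the slab certificate for MV-3 with the
# LUR'E–POSTNIKOV levels: rank-one facts against the LOWER matrix `P + Cᵀ·diag(λa)·C`, the
# POPOV-ONLY level `c < λ_e a_e γ_lo²` (no matrix fact), and their sum

LADDER-GRIDFUSION G2 «SP–Lur'e lane», generic receptacle (LOW infrastructure; lead g8 RULING 9h (2): «the
next-wave lever for NE39SP / K2A LP rows»); seat gridfusion-lit-6 (g8). Companion of model-2's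
`StructurePreservingSlabRankOne.lean` (`Params.tendsto_relState_of_slabCertificate_of_rankOne_window`:
per-line facts `s_e·P − C_eᵀC_e ⪰ 0` and the closed test `c·s_e ≤ γ_lo²`), with the SAME shape and the
SAME closing theorem (model-2's `Params.tendsto_relState_of_slabCertificate`, whose face hypothesis `hfr`
is an input), but the face hypothesis discharged by lit-6's
`Literature/MathematicalPhysics/PowerSystems/LuriePostnikovSlabPositivity.lean`:

* `…_of_lowerRankOne_window` — per-line facts against the LOWER comparison matrix of the certificate,
  `s_e·(P + Cᵀ·diag(λ_e a_e)·C) − C_eᵀC_e ⪰ 0` (`LPSlabCertificate.lt_V_of_mem_frontier_slab` through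
  `SlabCertificate.toLP`; never worse than the rank-one level since the lower matrix dominates `P`;
  measured ×8.2 over the best old-class rank-one level and ×220 over the ε-level on ★ #45's object,
  «#45″ LEVEL-LP» p544744);
* `…_of_popov_window` — NO matrix fact: the closed test `c < λ_e·a_e·γ_lo²` on every listed line
  (`SlabCertificate.lt_V_of_mem_frontier_slab_of_popov`: at the tight line `V ≥ xᵀPx + λ_e a_e γ²`;
  measured ×2458 over the uniform rank-one level on ★ #53's object, «#53-POPOV LEVEL» p546317);
* `…_of_rankOne_popov_window` — the two face bounds ADDED: old per-line facts `s_e·P − C_eᵀC_e ⪰ 0`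
  and the closed test `c ≤ γ_lo²/s_e + λ_e·a_e·γ_lo²` (`SlabCertificate.lt_V_of_mem_frontier_slab_of_rankOne_popov`);
and the printed-vocabulary (`p.IsSolution δ`) twin of the Popov-only form; plus the receptacle
`relState_mem_well_of_lpSlabCertificate` (+ `relState_mem_lpWell_iff`) for a GENUINE `Λ : LPSlabCertificate`
on the relative object (`P` possibly singular; raw `hsec`/`hfr` inputs; the well-phrased analogue of model-2's
`tendsto_relState_of_slabCertificate`),
which is what a producer object of the LP class (sos-4's low-damping census) will be typed against.
Everything else verbatim as in
the window/rank-one files (sectors from the typed window `|σ*_e| ≤ 2·arctan τ`, `a_e ≤ a₀(u)` exact, `b_e ≥ 1`,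
initial test `|σ_e(0) − σ*_e| ≤ γ_lo`, `γ_lo²(1 + u²) ≤ 4u²`).
THREE COLUMNS: MODELLED column only (typing); no certificate here; an instance supplies `Λ` and decides the
closed rational tests; nothing here says a grid is stable. MODELLED: absent effects = MODEL-VALIDITY MV-3.
[cite: Pai1981, §2.16 Theorem [18] and §4.6 eqs. (4.45)–(4.46); Khalil2002, §7.1.2 Theorem 7.3; VuTuritsyn2017, §4.3 Theorem 1 with eq. (V_min)]
-/

noncomputable section

open Finset Real Set Filter Matrix
open scoped Topology
open Literature.MathematicalPhysics.PowerSystems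
open Literature.MathematicalPhysics.PowerSystems.LyapunovFunctionFamily

namespace Summit.Ventures.GridStability.Models.StructurePreserving.Params

variable {k g m : ℕ} {p : Params (k + 1)} {r : Fin (k + 1)} {gnode : Fin g → Fin (k + 1)}
  {src tgt : Fin m → Fin (k + 1)} {wt : Fin m → ℝ} {δs : Fin (k + 1) → ℝ}

/-- **The Popov level from the closed test**: if `0 ≤ γ_lo < γ`, `λ_e a_e ≥ 0` and `c < λ_e a_e γ_lo²`
on every listed line, then `c < λ_e a_e γ²`. [cite: Pai1981, §4.6 eq. (4.46)] -/
theorem level_lt_of_popov_test {γ γlo c : ℝ} {la : Fin m → ℝ} (hγ0 : 0 ≤ γlo) (hlt : γlo < γ)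
    (hla : ∀ e, 0 ≤ la e) (hc : ∀ e, c < la e * γlo ^ 2) (e : Fin m) : c < la e * γ ^ 2 := by
  have hsq : γlo ^ 2 ≤ γ ^ 2 := pow_le_pow_left₀ hγ0 hlt.le 2
  exact (hc e).trans_le (mul_le_mul_of_nonneg_left hsq (hla e))

/-- **The summed level from the closed test**: if `0 ≤ γ_lo < γ`, `s_e > 0`, `λ_e a_e ≥ 0` and
`c ≤ γ_lo²/s_e + λ_e a_e γ_lo²` on every listed line, then `c < γ²/s_e + λ_e a_e γ²` (strict from the
first summand). [cite: Pai1981, §4.6 eq. (4.46); VuTuritsyn2017, §4.3 eq. (V_min)] -/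
theorem level_lt_of_rankOne_popov_test {γ γlo c : ℝ} {s la : Fin m → ℝ} (hγ0 : 0 ≤ γlo)
    (hlt : γlo < γ) (hs0 : ∀ e, 0 < s e) (hla : ∀ e, 0 ≤ la e)
    (hc : ∀ e, c ≤ γlo ^ 2 / s e + la e * γlo ^ 2) (e : Fin m) :
    c < γ ^ 2 / s e + la e * γ ^ 2 := by
  have hsq : γlo ^ 2 < γ ^ 2 := pow_lt_pow_left₀ hlt hγ0 two_ne_zero
  have h1 : γlo ^ 2 / s e < γ ^ 2 / s e := div_lt_div_of_pos_right hsq (hs0 e)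
  have h2 : la e * γlo ^ 2 ≤ la e * γ ^ 2 := mul_le_mul_of_nonneg_left hsq.le (hla e)
  exact (hc e).trans_lt (by linarith)

/-- **SLAB CERTIFICATE FOR MV-3 WITH THE LOWER-MATRIX RANK-ONE LEVEL.** As
`tendsto_relState_of_slabCertificate_of_rankOne_window`, but the per-line facts are against the
certificate's LOWER comparison matrix, `s_e·(P + Cᵀ·diag(λ_e a_e)·C) − C_eᵀC_e ⪰ 0`, `s_e > 0`, with the
same closed test `c·s_e ≤ γ_lo²` (lit-6's `LPSlabCertificate.lt_V_of_mem_frontier_slab` through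
`SlabCertificate.toLP`: on the closed slab `V ≥ xᵀ(P + Cᵀdiag(λa)C)x`). Conclusion unchanged: every phase
solution of `p.phaseField` with `|σ_e(0) − σ*_e| ≤ γ_lo` and `V(relState(X 0)) ≤ c` keeps
`|σ_e(t) − σ*_e| < 2·arctan u` and `V ≤ c` for all `t ≥ 0`, and its relative state tends to `0`. CERTIFIED
given `Λ` and the `s_e` facts; MODEL MV-3; inner estimate (never smaller than the rank-one level's at the
same `Λ`). [cite: Khalil2002, §7.1.2 Theorem 7.3 (loop-transformed Popov function); Pai1981, §2.16 Theorem [18] and §4.6 eqs. (4.45)–(4.46); VuTuritsyn2017, §4.3 Theorem 1 with eq. (V_min)] -/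
theorem tendsto_relState_of_slabCertificate_of_lowerRankOne_window (hp : p.WellFormed) (hr : r ∉ p.gen)
    (hginj : Function.Injective gnode) (hgen : ∀ v, v ∈ p.gen ↔ ∃ j, gnode j = v)
    (hb : p.b = symmetrize (edgeWeight src tgt wt)) (hP : ∀ v, p.pe δs v = p.P0 v)
    (Λ : SlabCertificate (p.relLurie r gnode src tgt wt δs))
    {τ : ℝ} (hτ1 : τ < 1) (hwin : ∀ e, |δs (src e) - δs (tgt e)| ≤ 2 * Real.arctan τ)
    {u γlo : ℝ} (hu0 : 0 < u) (hu1 : u ≤ 1) (hγ0 : 0 ≤ γlo)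
    (hγ : γlo ^ 2 * (1 + u ^ 2) ≤ 4 * u ^ 2)
    (ha : ∀ e, Λ.a e ≤ ((1 - τ ^ 2) * (1 - u ^ 2) - 4 * τ * u) / ((1 + τ ^ 2) * (1 + u ^ 2)))
    (hb1 : ∀ e, 1 ≤ Λ.b e)
    {s : Fin m → ℝ} (hs0 : ∀ e, 0 < s e)
    (hs : ∀ e, (s e • Λ.toLP.lowerMatrix - Matrix.vecMulVec ((p.relLurie r gnode src tgt wt δs).C e)
      ((p.relLurie r gnode src tgt wt δs).C e)).PosSemidef)
    {c : ℝ} (hc : ∀ e, c * s e ≤ γlo ^ 2)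
    {X : ℝ → (Fin (k + 1) → ℝ) × (Fin (k + 1) → ℝ)}
    (hX : ∀ T : ℝ, ∀ t ∈ Icc 0 T, HasDerivWithinAt X (p.phaseField (X t)) (Icc 0 T) t)
    (h0 : ∀ e, |((X 0).1 (src e) - (X 0).1 (tgt e)) - (δs (src e) - δs (tgt e))| ≤ γlo)
    (hVc : Λ.V (relState r gnode δs (X 0)) ≤ c) :
    (∀ t, 0 ≤ t →
        (∀ e, |((X t).1 (src e) - (X t).1 (tgt e)) - (δs (src e) - δs (tgt e))|
          < 2 * Real.arctan u) ∧
        Λ.V (relState r gnode δs (X t)) ≤ c) ∧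
      Tendsto (fun t => relState r gnode δs (X t)) atTop (𝓝 0) := by
  have hγpos : 0 ≤ 2 * Real.arctan u := Lyapunov.StructurePreserving.two_mul_arctan_nonneg hu0.le
  have hθγ : 2 * Real.arctan τ + 2 * Real.arctan u ≤ π := (two_arctan_add_lt_pi hτ1 hu1).le
  have ha' : ∀ e, Λ.a e ≤ Real.cos (2 * Real.arctan τ + 2 * Real.arctan u) := fun e => by
    rw [cos_two_arctan_add]; exact ha e
  have hsec := relLurie_slab_sector_of_window (p := p) (r := r) (gnode := gnode) (src := src)
    (tgt := tgt) (wt := wt) (δs := δs) Λ hγpos hθγ hwin ha' hb1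
  have hlt : γlo < 2 * Real.arctan u := lt_two_arctan_of_sq_le hu0 hγ0 hγ
  have hc' : ∀ e : Fin m, c < (2 * Real.arctan u) ^ 2 / s e :=
    level_lt_of_rankOne_test hγ0 hlt hs0 hc
  have hfr : ∀ x ∈ frontier ((p.relLurie r gnode src tgt wt δs).slab (fun _ => 2 * Real.arctan u)),
      c < Λ.V x := fun x hx => by
    have h := Λ.toLP.lt_V_of_mem_frontier_slab (γ := fun _ => 2 * Real.arctan u) hsec hs0 hs hc' hx
    rwa [SlabCertificate.toLP_V] at h
  have h0' : ∀ e, |((X 0).1 (src e) - (X 0).1 (tgt e)) - (δs (src e) - δs (tgt e))|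
      < 2 * Real.arctan u := fun e => (h0 e).trans_lt hlt
  exact tendsto_relState_of_slabCertificate hp hr hginj hgen hb hP Λ hsec hfr hX h0' hVc

/-- **SLAB CERTIFICATE FOR MV-3 WITH THE POPOV-ONLY LEVEL — NO MATRIX FACT.** As
`tendsto_relState_of_slabCertificate_of_window`, but the level comes from the closed rational test
`c < λ_e·a_e·γ_lo²` on every listed line (lit-6's `SlabCertificate.lt_V_of_mem_frontier_slab_of_popov`:
at a tight line `|y_e| = γ` the Popov integral alone gives `V ≥ xᵀPx + λ_e a_e γ² ≥ λ_e a_e γ²`).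
Conclusion unchanged (slab `< 2·arctan u` and `V ≤ c` kept; relative state → 0). CERTIFIED given `Λ`;
MODEL MV-3; inner estimate. [cite: Pai1981, §2.16 Theorem [18] and §4.6 eqs. (4.45)–(4.46); Khalil2002, §7.1.2 Theorem 7.3; VuTuritsyn2017, §4.3 Theorem 1] -/
theorem tendsto_relState_of_slabCertificate_of_popov_window (hp : p.WellFormed) (hr : r ∉ p.gen)
    (hginj : Function.Injective gnode) (hgen : ∀ v, v ∈ p.gen ↔ ∃ j, gnode j = v)
    (hb : p.b = symmetrize (edgeWeight src tgt wt)) (hP : ∀ v, p.pe δs v = p.P0 v)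
    (Λ : SlabCertificate (p.relLurie r gnode src tgt wt δs))
    {τ : ℝ} (hτ1 : τ < 1) (hwin : ∀ e, |δs (src e) - δs (tgt e)| ≤ 2 * Real.arctan τ)
    {u γlo : ℝ} (hu0 : 0 < u) (hu1 : u ≤ 1) (hγ0 : 0 ≤ γlo)
    (hγ : γlo ^ 2 * (1 + u ^ 2) ≤ 4 * u ^ 2)
    (ha : ∀ e, Λ.a e ≤ ((1 - τ ^ 2) * (1 - u ^ 2) - 4 * τ * u) / ((1 + τ ^ 2) * (1 + u ^ 2)))
    (hb1 : ∀ e, 1 ≤ Λ.b e)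
    {c : ℝ} (hc : ∀ e, c < Λ.lam e * Λ.a e * γlo ^ 2)
    {X : ℝ → (Fin (k + 1) → ℝ) × (Fin (k + 1) → ℝ)}
    (hX : ∀ T : ℝ, ∀ t ∈ Icc 0 T, HasDerivWithinAt X (p.phaseField (X t)) (Icc 0 T) t)
    (h0 : ∀ e, |((X 0).1 (src e) - (X 0).1 (tgt e)) - (δs (src e) - δs (tgt e))| ≤ γlo)
    (hVc : Λ.V (relState r gnode δs (X 0)) ≤ c) :
    (∀ t, 0 ≤ t →
        (∀ e, |((X t).1 (src e) - (X t).1 (tgt e)) - (δs (src e) - δs (tgt e))|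
          < 2 * Real.arctan u) ∧
        Λ.V (relState r gnode δs (X t)) ≤ c) ∧
      Tendsto (fun t => relState r gnode δs (X t)) atTop (𝓝 0) := by
  have hγpos : 0 ≤ 2 * Real.arctan u := Lyapunov.StructurePreserving.two_mul_arctan_nonneg hu0.le
  have hθγ : 2 * Real.arctan τ + 2 * Real.arctan u ≤ π := (two_arctan_add_lt_pi hτ1 hu1).le
  have ha' : ∀ e, Λ.a e ≤ Real.cos (2 * Real.arctan τ + 2 * Real.arctan u) := fun e => by
    rw [cos_two_arctan_add]; exact ha e
  have hsec := relLurie_slab_sector_of_window (p := p) (r := r) (gnode := gnode) (src := src)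
    (tgt := tgt) (wt := wt) (δs := δs) Λ hγpos hθγ hwin ha' hb1
  have hlt : γlo < 2 * Real.arctan u := lt_two_arctan_of_sq_le hu0 hγ0 hγ
  have hc' : ∀ e : Fin m, c < Λ.lam e * Λ.a e * (2 * Real.arctan u) ^ 2 :=
    level_lt_of_popov_test (la := fun e => Λ.lam e * Λ.a e) hγ0 hlt Λ.lam_mul_a_nonneg hc
  have hfr : ∀ x ∈ frontier ((p.relLurie r gnode src tgt wt δs).slab (fun _ => 2 * Real.arctan u)),
      c < Λ.V x := fun x hx =>
    Λ.lt_V_of_mem_frontier_slab_of_popov (γ := fun _ => 2 * Real.arctan u) hsec hc' hx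
  have h0' : ∀ e, |((X 0).1 (src e) - (X 0).1 (tgt e)) - (δs (src e) - δs (tgt e))|
      < 2 * Real.arctan u := fun e => (h0 e).trans_lt hlt
  exact tendsto_relState_of_slabCertificate hp hr hginj hgen hb hP Λ hsec hfr hX h0' hVc

/-- **SLAB CERTIFICATE FOR MV-3 WITH THE RANK-ONE + POPOV LEVEL.** As
`tendsto_relState_of_slabCertificate_of_rankOne_window` (per-line facts `s_e·P − C_eᵀC_e ⪰ 0`, `s_e > 0`),
but the closed test is `c ≤ γ_lo²/s_e + λ_e·a_e·γ_lo²` — the rank-one face bound and the Popov face bound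
ADD (lit-6's `SlabCertificate.lt_V_of_mem_frontier_slab_of_rankOne_popov`; Pai's
`M₁ = ℓ₁²/cᵀP⁻¹c + q∫₀^{ℓ₁}φ`). Conclusion unchanged. CERTIFIED given `Λ` and the `s_e` facts; MODEL MV-3;
inner estimate. [cite: Pai1981, §4.6 eq. (4.46); VuTuritsyn2017, §4.3 Theorem 1 with eq. (V_min)] -/
theorem tendsto_relState_of_slabCertificate_of_rankOne_popov_window (hp : p.WellFormed)
    (hr : r ∉ p.gen) (hginj : Function.Injective gnode) (hgen : ∀ v, v ∈ p.gen ↔ ∃ j, gnode j = v)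
    (hb : p.b = symmetrize (edgeWeight src tgt wt)) (hP : ∀ v, p.pe δs v = p.P0 v)
    (Λ : SlabCertificate (p.relLurie r gnode src tgt wt δs))
    {τ : ℝ} (hτ1 : τ < 1) (hwin : ∀ e, |δs (src e) - δs (tgt e)| ≤ 2 * Real.arctan τ)
    {u γlo : ℝ} (hu0 : 0 < u) (hu1 : u ≤ 1) (hγ0 : 0 ≤ γlo)
    (hγ : γlo ^ 2 * (1 + u ^ 2) ≤ 4 * u ^ 2)
    (ha : ∀ e, Λ.a e ≤ ((1 - τ ^ 2) * (1 - u ^ 2) - 4 * τ * u) / ((1 + τ ^ 2) * (1 + u ^ 2)))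
    (hb1 : ∀ e, 1 ≤ Λ.b e)
    {s : Fin m → ℝ} (hs0 : ∀ e, 0 < s e)
    (hs : ∀ e, (s e • Λ.P - Matrix.vecMulVec ((p.relLurie r gnode src tgt wt δs).C e)
      ((p.relLurie r gnode src tgt wt δs).C e)).PosSemidef)
    {c : ℝ} (hc : ∀ e, c ≤ γlo ^ 2 / s e + Λ.lam e * Λ.a e * γlo ^ 2)
    {X : ℝ → (Fin (k + 1) → ℝ) × (Fin (k + 1) → ℝ)}
    (hX : ∀ T : ℝ, ∀ t ∈ Icc 0 T, HasDerivWithinAt X (p.phaseField (X t)) (Icc 0 T) t)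
    (h0 : ∀ e, |((X 0).1 (src e) - (X 0).1 (tgt e)) - (δs (src e) - δs (tgt e))| ≤ γlo)
    (hVc : Λ.V (relState r gnode δs (X 0)) ≤ c) :
    (∀ t, 0 ≤ t →
        (∀ e, |((X t).1 (src e) - (X t).1 (tgt e)) - (δs (src e) - δs (tgt e))|
          < 2 * Real.arctan u) ∧
        Λ.V (relState r gnode δs (X t)) ≤ c) ∧
      Tendsto (fun t => relState r gnode δs (X t)) atTop (𝓝 0) := by
  have hγpos : 0 ≤ 2 * Real.arctan u := Lyapunov.StructurePreserving.two_mul_arctan_nonneg hu0.le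
  have hθγ : 2 * Real.arctan τ + 2 * Real.arctan u ≤ π := (two_arctan_add_lt_pi hτ1 hu1).le
  have ha' : ∀ e, Λ.a e ≤ Real.cos (2 * Real.arctan τ + 2 * Real.arctan u) := fun e => by
    rw [cos_two_arctan_add]; exact ha e
  have hsec := relLurie_slab_sector_of_window (p := p) (r := r) (gnode := gnode) (src := src)
    (tgt := tgt) (wt := wt) (δs := δs) Λ hγpos hθγ hwin ha' hb1
  have hlt : γlo < 2 * Real.arctan u := lt_two_arctan_of_sq_le hu0 hγ0 hγ
  have hc' : ∀ e : Fin m, c < (2 * Real.arctan u) ^ 2 / s e + Λ.lam e * Λ.a e * (2 * Real.arctan u) ^ 2 :=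
    level_lt_of_rankOne_popov_test (la := fun e => Λ.lam e * Λ.a e) hγ0 hlt hs0 Λ.lam_mul_a_nonneg hc
  have hfr : ∀ x ∈ frontier ((p.relLurie r gnode src tgt wt δs).slab (fun _ => 2 * Real.arctan u)),
      c < Λ.V x := fun x hx =>
    Λ.lt_V_of_mem_frontier_slab_of_rankOne_popov (γ := fun _ => 2 * Real.arctan u) hsec hs0 hs hc' hx
  have h0' : ∀ e, |((X 0).1 (src e) - (X 0).1 (tgt e)) - (δs (src e) - δs (tgt e))|
      < 2 * Real.arctan u := fun e => (h0 e).trans_lt hlt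
  exact tendsto_relState_of_slabCertificate hp hr hginj hgen hb hP Λ hsec hfr hX h0' hVc

/-- **The Popov-only level for the structure-preserving model AS PRINTED** (`p.IsSolution δ`, any `P⁰`,
synchronous equilibrium `δ*` with frequency `ω₀`; `|σ_e(0) − σ*_e| ≤ γ_lo`, `V ≤ c` for the initial
relative state `relState(δ(0), δ̇(0) − ω₀)`, `c < λ_e a_e γ_lo²`): deviations stay `< 2·arctan u`, every
angle difference tends to the equilibrium's, every generator speed tends to `ω₀`. MODEL MV-3; nothing
here says a grid is stable. [cite: Pai1981, §2.16 Theorem [18], §4.6 eq. (4.46) and §4.7; VuTuritsyn2017, §4.3 Theorem 1; Padiyar2013, §3.2 eq (3.2)] -/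
theorem tendsto_of_isSolution_of_slabCertificate_of_popov_window (hp : p.WellFormed) (hr : r ∉ p.gen)
    (hginj : Function.Injective gnode) (hgen : ∀ v, v ∈ p.gen ↔ ∃ j, gnode j = v)
    (hb : p.b = symmetrize (edgeWeight src tgt wt)) (hδeq : p.IsSyncEquilibrium δs)
    (Λ : SlabCertificate (p.relLurie r gnode src tgt wt δs))
    {τ : ℝ} (hτ1 : τ < 1) (hwin : ∀ e, |δs (src e) - δs (tgt e)| ≤ 2 * Real.arctan τ)
    {u γlo : ℝ} (hu0 : 0 < u) (hu1 : u ≤ 1) (hγ0 : 0 ≤ γlo)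
    (hγ : γlo ^ 2 * (1 + u ^ 2) ≤ 4 * u ^ 2)
    (ha : ∀ e, Λ.a e ≤ ((1 - τ ^ 2) * (1 - u ^ 2) - 4 * τ * u) / ((1 + τ ^ 2) * (1 + u ^ 2)))
    (hb1 : ∀ e, 1 ≤ Λ.b e)
    {c : ℝ} (hc : ∀ e, c < Λ.lam e * Λ.a e * γlo ^ 2)
    {δ : ℝ → Fin (k + 1) → ℝ} (hδ : p.IsSolution δ)
    (h0 : ∀ e, |(δ 0 (src e) - δ 0 (tgt e)) - (δs (src e) - δs (tgt e))| ≤ γlo)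
    (hVc : Λ.V (relState r gnode δs (δ 0, fun v => deriv (fun u => δ u v) 0 - p.syncFreq)) ≤ c) :
    (∀ t, 0 ≤ t → ∀ e, |(δ t (src e) - δ t (tgt e)) - (δs (src e) - δs (tgt e))|
        < 2 * Real.arctan u) ∧
      (∀ v w, Tendsto (fun t => δ t v - δ t w) atTop (𝓝 (δs v - δs w))) ∧
      ∀ v ∈ p.gen, Tendsto (fun t => deriv (fun u => δ u v) t) atTop (𝓝 p.syncFreq) := by
  have hγpos : 0 ≤ 2 * Real.arctan u := Lyapunov.StructurePreserving.two_mul_arctan_nonneg hu0.le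
  have hθγ : 2 * Real.arctan τ + 2 * Real.arctan u ≤ π := (two_arctan_add_lt_pi hτ1 hu1).le
  have ha' : ∀ e, Λ.a e ≤ Real.cos (2 * Real.arctan τ + 2 * Real.arctan u) := fun e => by
    rw [cos_two_arctan_add]; exact ha e
  have hsec := relLurie_slab_sector_of_window (p := p) (r := r) (gnode := gnode) (src := src)
    (tgt := tgt) (wt := wt) (δs := δs) Λ hγpos hθγ hwin ha' hb1
  have hlt : γlo < 2 * Real.arctan u := lt_two_arctan_of_sq_le hu0 hγ0 hγ
  have hc' : ∀ e : Fin m, c < Λ.lam e * Λ.a e * (2 * Real.arctan u) ^ 2 :=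
    level_lt_of_popov_test (la := fun e => Λ.lam e * Λ.a e) hγ0 hlt Λ.lam_mul_a_nonneg hc
  have hfr : ∀ x ∈ frontier ((p.relLurie r gnode src tgt wt δs).slab (fun _ => 2 * Real.arctan u)),
      c < Λ.V x := fun x hx =>
    Λ.lt_V_of_mem_frontier_slab_of_popov (γ := fun _ => 2 * Real.arctan u) hsec hc' hx
  have h0' : ∀ e, |(δ 0 (src e) - δ 0 (tgt e)) - (δs (src e) - δs (tgt e))|
      < 2 * Real.arctan u := fun e => (h0 e).trans_lt hlt
  exact tendsto_of_isSolution_of_slabCertificate hp hr hginj hgen hb hδeq Λ hsec hfr hδ h0' hVc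

/-! ## The receptacle for a GENUINE `LPSlabCertificate` on the relative object (P possibly singular) -/

/-- **Lur'e–Postnikov-POSITIVE slab certificate for MV-3 (phase solutions, frame `P⁰ = f(δ*)`).** The
receptacle for a certificate of lit-6's LP class (`LPSlabCertificate`: coercivity only through
`P + Cᵀ·diag(λa)·C ⪰ ε·1`, `P` possibly singular) on the relative object — the analogue of model-2's
`tendsto_relState_of_slabCertificate`, phrased with the certified WELL `Λ.well γ c = {x ∈ slab γ : V x ≤ c}`
(`LPSlabCertificate.mem_well_iff`, `mem_slab_relState_iff` unpack it to the listed line-angle deviations):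
data well formed, reference load bus `r ∉ gen`, injective enumeration of `gen`, edge-list couplings, an exact
`Λ : LPSlabCertificate` whose channel sectors hold on the slab `γ` (`hsec`) with a level `c < V` on the slab
faces (`hfr`, e.g. `LPSlabCertificate.lt_V_of_mem_frontier_slab` / `_of_popov`). Conclusion: every phase
solution `X` of `p.phaseField` whose initial relative state lies in the well keeps its relative state in the
well for all `t ≥ 0`, and the relative state tends to `0`. CERTIFIED given `Λ`; MODEL MV-3; inner estimate.
[cite: Khalil2002, §7.1.2 Theorem 7.3; Pai1981, §2.16 Theorem [18] and §4.6–§4.7; VuTuritsyn2017, §4.3 Theorem 1] -/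
theorem relState_mem_well_of_lpSlabCertificate (hp : p.WellFormed) (hr : r ∉ p.gen)
    (hginj : Function.Injective gnode) (hgen : ∀ v, v ∈ p.gen ↔ ∃ j, gnode j = v)
    (hb : p.b = symmetrize (edgeWeight src tgt wt)) (hP : ∀ v, p.pe δs v = p.P0 v)
    (Λ : LPSlabCertificate (p.relLurie r gnode src tgt wt δs)) {γ : Fin m → ℝ}
    (hsec : ∀ e ξ, |ξ - (p.relLurie r gnode src tgt wt δs).δs e| ≤ γ e →
      Λ.a e ≤ Real.cos ξ ∧ Real.cos ξ ≤ Λ.b e)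
    {c : ℝ} (hfr : ∀ x ∈ frontier ((p.relLurie r gnode src tgt wt δs).slab γ), c < Λ.V x)
    {X : ℝ → (Fin (k + 1) → ℝ) × (Fin (k + 1) → ℝ)}
    (hX : ∀ T : ℝ, ∀ t ∈ Icc 0 T, HasDerivWithinAt X (p.phaseField (X t)) (Icc 0 T) t)
    (hy : relState r gnode δs (X 0) ∈ Λ.well γ c) :
    (∀ t, 0 ≤ t → relState r gnode δs (X t) ∈ Λ.well γ c) ∧
      Tendsto (fun t => relState r gnode δs (X t)) atTop (𝓝 0) := by
  have hrel : ∀ T : ℝ, ∀ t ∈ Icc 0 T, HasDerivWithinAt (fun τ => relState r gnode δs (X τ))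
      ((p.relLurie r gnode src tgt wt δs).field (relState r gnode δs (X t))) (Icc 0 T) t :=
    fun T t ht => hasDerivWithinAt_relState hp hr hginj hgen hb hP (hX T t ht)
  obtain ⟨-, hall⟩ := Λ.well_subset_regionOfAttraction hsec hfr hy
  exact hall (fun τ => relState r gnode δs (X τ)) rfl hrel

/-- The initial-well test in MV-3 terms: `relState(y) ∈ Λ.well γ c` iff every listed line-angle deviation of
`y` satisfies `|σ_e − σ*_e| < γ_e` and `V(relState y) ≤ c`. [cite: VuTuritsyn2017, §4.3 Theorem 1 (set ℛ)] -/
theorem relState_mem_lpWell_iff (Λ : LPSlabCertificate (p.relLurie r gnode src tgt wt δs))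
    (γ : Fin m → ℝ) (c : ℝ) (y : (Fin (k + 1) → ℝ) × (Fin (k + 1) → ℝ)) :
    relState r gnode δs y ∈ Λ.well γ c ↔
      (∀ e, |(y.1 (src e) - y.1 (tgt e)) - (δs (src e) - δs (tgt e))| < γ e) ∧
        Λ.V (relState r gnode δs y) ≤ c := by
  rw [LPSlabCertificate.mem_well_iff, mem_slab_relState_iff]

end Summit.Ventures.GridStability.Models.StructurePreserving.Params

end
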